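import Literature.NumberTheory.PAdicHodge.TateH1Reduction
import Literature.NumberTheory.PAdicHodge.FiniteLayerCoboundary
import Literature.NumberTheory.PAdicHodge.TateSenCocycles
import Mathlib.FieldTheory.Galois.Profinite
import HarnessLib

/-!
# Tate 1967 §3.3 Theorem 1 over `ℚ_p(μ_{p^∞})`: a continuous cocycle of `Gal(F̄/ℚ_p)` in `ℂ_F` trivial on
# `Gal(F̄/ℚ_p(μ_{p^∞}))` is `c · λ + ∂b` — the LINE `H¹ = ℚ_p · λ`, PROVED

Continuation of `TateH1Reduction` (density-free reduction), `FiniteLayerCoboundary` (finite layer) and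
`TateSenCocycles` (edix-p4: `H¹_cont(ker χ, ℂ_F) = 0` granted (TS1); here only its continuity lemma
`TateSen.continuous_base_smul_left` is used). Notation: `K₀ = PadicBase F p hp ≅ ℚ_p`, `F̄`, `ℂ_F`,
`G₀ = Gal(F̄/K₀)` with its Krull topology (compact, Mathlib), `H = {g | g • ζ_{p^M} = ζ_{p^M} ∀ M}`,
`γ = gen n`, `ι : K₀ → ℂ_F`. THEOREMS ONLY; no named fact, no `sorry`.

* `TateH1.mul_apply_eq_mul_apply_gen_of_reduced` — **the continuity step WITHOUT a density argument**: for a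
  reduced continuous cocycle `f` trivial on `H` and any continuous additive `λ : G₀ → K₀` trivial on `H`,
  `λ(γ) f(g) = λ(g) f(γ)` for every `g ∈ Gal(F̄/K n)`. With `γ^{k_M} ≡ g` on `K M` (`Gal(K M/K n) = ⟨γ⟩`,
  tree `exists_pow_gen_smul_eq_of_smul_zeta_eq`) the elements `u_M = γ^{-k_M} g ∈ Gal(F̄/K M)` all satisfy
  `D(u_M) = D(g)` for the continuous defect `D = λ(γ) f − λ(·) f(γ)`; the closed sets
  `{u ∈ Gal(F̄/K M) | D u = D g}` (stabilisers of `ζ_{p^M}` are open subgroups, hence closed) are nested and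
  non-empty in the COMPACT group `G₀`, so they share a point of `H = ⋂_M Gal(F̄/K M)`, where `D = 0`.
* `TateH1.exists_eq_mul_add_coboundary_of_reduced`, **`TateH1.exists_eq_mul_add_coboundary`** — for every
  continuous `1`-cocycle `f : G₀ → ℂ_F` vanishing on `H` and every continuous additive `λ : G₀ → K₀` vanishing
  on `H` with `λ(gen n) ≠ 0` (`n ≥ 2`): **`f(g) = ι(c · λ(g)) + (g • b − b)`** for some `c ∈ K₀`, `b ∈ ℂ_F`
  (reduction `TateH1.exists_reduce`; `f(γ) = ι r₀`; `c = r₀/λ(γ)`; the cocycle `f − ι(cλ)` vanishes on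
  `Gal(F̄/K n)` by the continuity step, hence is a coboundary by `FiniteLayer.exists_eq_smul_sub_of_forall_fixingSubgroup`).

With `λ = log χ_cyclo` (continuous additive, kills `H`, `log χ(γ) ≠ 0` since `χ(γ)` has infinite order — tree
`zpow_chi_gen_ne_one`, `unitLog_eq_zero_iff`) and `TateSen.baseKer_exists_eq_smul_sub_of_TS1` (first subtract
the coboundary trivialising `f` on `H`), this is **Tate's `H¹_cont(Gal(F̄/ℚ_p), ℂ_F) = ℚ_p · [log χ]`** granted
(TS1); injectivity of the line is the tree's `TateLogCyclotomicClass`. Remaining for Kato II 1.2.3 (b) (NOT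
here): continuity of `log χ_cyclo` on `G₀` as a named lemma, the transfer `G₀ ⇝ Γ_F` (edix-p2's b5), the twisted
vanishing assembled with `TateTwistCoboundary`, the Hodge–Tate decomposition of `V_pE`, and the dévissage.

## References
* J. Tate, *p-divisible groups* (1967), §3.2 Prop. 7–8, §3.3 Theorem 1. [Tate1967]
* J.-M. Fontaine, Y. Ouyang, *Theory of p-adic Galois representations*, §3.2 Prop. 3.19, Thm. 3.21. [FontaineOuyang2022]
-/

noncomputable section

open ValuativeRel Field UniformSpace Filter Topology Finset

open scoped IntermediateField

namespace Literature.NumberTheory.PAdicHodge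

open Literature.NumberTheory.GaloisRepresentations
open Literature.NumberTheory.GaloisRepresentations.IsNonarchimedeanLocalField
open CyclotomicTower TateTrace

variable {F : Type} [Field F] [ValuativeRel F] [TopologicalSpace F] [IsNonarchimedeanLocalField F]
  [CharZero F] {p : ℕ} [Fact p.Prime] (hp : valuation F p < 1)

namespace TateH1

variable {f : BaseGaloisGroup hp → CompletedAlgClosure F}

/-! ### Topological preliminaries on `G₀` (Krull topology: compact; stabilisers of `ζ_{p^M}` are clopen) -/

/-- The stabiliser of `ζ_{p^M}` in `G₀` is the fixing subgroup of `K M = K₀(ζ_{p^M})`. [cite: Tate1967, §3.1] -/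
theorem setOf_smul_zeta_eq (M : ℕ) :
    {u : BaseGaloisGroup hp | u • zeta F p M = zeta F p M} = ((K hp M).fixingSubgroup : Set (BaseGaloisGroup hp)) := by
  ext u
  simp only [Set.mem_setOf_eq, SetLike.mem_coe, IntermediateField.mem_fixingSubgroup_iff]
  constructor
  · intro hu x hx
    have h1 : u • zeta F p M = (1 : BaseGaloisGroup hp) • zeta F p M := by rw [hu, one_smul]
    have := smul_eq_smul_of_smul_zeta_eq hp h1 hx
    rwa [one_smul] at this
  · intro hu
    exact hu _ (zeta_mem_K hp M)

/-- The stabiliser of `ζ_{p^M}` is closed in the Krull topology (an open subgroup). [cite: Tate1967, §3.1] -/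
theorem isClosed_setOf_smul_zeta_eq (M : ℕ) :
    IsClosed {u : BaseGaloisGroup hp | u • zeta F p M = zeta F p M} := by
  haveI : FiniteDimensional (PadicBase F p hp) (K hp M) :=
    IntermediateField.adjoin.finiteDimensional (Algebra.IsIntegral.isIntegral (zeta F p M))
  rw [setOf_smul_zeta_eq hp M]
  exact Subgroup.isClosed_of_isOpen _ (IntermediateField.fixingSubgroup_isOpen (K hp M))

/-- Fixing `ζ_{p^{M'}}` implies fixing `ζ_{p^M}` for `M ≤ M'`. [folklore] -/
private theorem smul_zeta_eq_of_le {M M' : ℕ} (h : M ≤ M') {u : BaseGaloisGroup hp}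
    (hu : u • zeta F p M' = zeta F p M') : u • zeta F p M = zeta F p M := by
  obtain ⟨i, hi⟩ := exists_zeta_eq_pow (F := F) (p := p) h
  rw [hi, smul_pow', hu]

/-! ### The analytic step: `λ(γ) f(g) = λ(g) f(γ)` on `Gal(F̄/K n)` for a reduced continuous cocycle -/

/-- **Tate's continuity step** (density of `γ^ℤ · H` replaced by compactness). Let `f` be a CONTINUOUS cocycle
of `G₀` in `ℂ_F` vanishing on `H = Gal(F̄/K_∞)` and REDUCED (`R_n f(γ) = f(γ)`, `γ = gen n`, `n ≥ 2`), and let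
`λ : G₀ → K₀` be any continuous additive function vanishing on `H`. Then for every `g` fixing `ζ_{p^n}`:
`λ(γ) · f(g) = λ(g) · f(γ)`. Proof: with `γ^{k_M} ≡ g` on `K M` (`Gal(K M/K n) = ⟨γ⟩`), the elements
`u_M = γ^{-k_M} g ∈ Gal(F̄/K M)` all have `D(u_M) = D(g)` for `D = λ(γ) f − λ(·) f(γ)` (`f` is `γ`-fixed,
`f(γ)` is `G₀`-fixed, `f(γ^k) = k f(γ)`); the closed sets `{u ∈ Gal(F̄/K M) | D u = D g}` are nested and
nonempty in the compact `G₀`, so they share a point `u ∈ H`, where `D` vanishes.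
[cite: Tate1967, §3.3 Theorem 1] [cite: FontaineOuyang2022, §3.2 Thm. 3.21] -/
theorem mul_apply_eq_mul_apply_gen_of_reduced {n : ℕ} (hn : 2 ≤ n)
    (hcoc : ∀ g h : BaseGaloisGroup hp, f (g * h) = f g + g • f h)
    (hH : ∀ h : BaseGaloisGroup hp, (∀ M, h • zeta F p M = zeta F p M) → f h = 0)
    (hcont : Continuous f)
    (hred : Rhat hp n ⟨f (gen hp n), mem_X hp hcoc hH _⟩ = f (gen hp n))
    (lam : BaseGaloisGroup hp → PadicBase F p hp) (hlam : ∀ g h, lam (g * h) = lam g + lam h)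
    (hlamH : ∀ h : BaseGaloisGroup hp, (∀ M, h • zeta F p M = zeta F p M) → lam h = 0)
    (hlamc : Continuous lam) {g : BaseGaloisGroup hp} (hg : g • zeta F p n = zeta F p n) :
    ι hp (lam (gen hp n)) * f g = ι hp (lam g) * f (gen hp n) := by
  haveI : IsGalois (PadicBase F p hp) (NormedAlgClosure F) := inferInstance
  set γ := gen hp n with hγ
  set r := f γ with hr
  -- the defect `D`
  set D : BaseGaloisGroup hp → CompletedAlgClosure F := fun u => ι hp (lam γ) * f u - ι hp (lam u) * r with hD
  have hDcont : Continuous D := by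
    have hι : Continuous (ι hp) := (AddMonoidHomClass.isometry_of_norm (ιHom hp) (norm_ι hp)).continuous
    exact (continuous_const.mul hcont).sub ((hι.comp hlamc).mul continuous_const)
  -- values: `f` is `γ^k`-fixed, `r` is `G₀`-fixed, `f(γ^k) = k r`, `f((γ^k)⁻¹) = -k r`
  have hr_fix : ∀ u : BaseGaloisGroup hp, u • r = r := smul_apply_gen_eq hp hn hcoc hH hred
  have hf1 : f 1 = 0 := by
    have h := hcoc 1 1
    rw [one_mul, one_smul] at h
    linear_combination (-1 : CompletedAlgClosure F) * h
  have hlam1 : lam 1 = 0 := by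
    have h := hlam 1 1
    rw [one_mul] at h
    linear_combination (-1 : PadicBase F p hp) * h
  have hγk_fix : ∀ (k : ℕ) (u : BaseGaloisGroup hp), (γ ^ k)⁻¹ • f u = f u := by
    intro k u
    have h1 : ∀ j : ℕ, γ ^ j • f u = f u := by
      intro j
      induction j with
      | zero => rw [pow_zero, one_smul]
      | succ j ih => rw [pow_succ, mul_smul, gen_smul_apply_eq hp hn hcoc hH hred u, ih]
    rw [inv_smul_eq_iff, h1 k]
  have hfinv : ∀ k : ℕ, f ((γ ^ k)⁻¹) = -((k : CompletedAlgClosure F) * r) := by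
    intro k
    have h := hcoc ((γ ^ k)⁻¹) (γ ^ k)
    have hnat : (γ ^ k)⁻¹ • ((k : ℕ) : CompletedAlgClosure F) = k :=
      map_natCast (MulSemiringAction.toRingHom (BaseGaloisGroup hp) (CompletedAlgClosure F) ((γ ^ k)⁻¹)) k
    rw [inv_mul_cancel, hf1, apply_gen_pow hp hn hcoc hH hred k, smul_mul', hr_fix, hnat] at h
    linear_combination -h
  have hlaminv : ∀ k : ℕ, lam ((γ ^ k)⁻¹) = -((k : PadicBase F p hp) * lam γ) := by
    intro k
    have hpow : ∀ j : ℕ, lam (γ ^ j) = (j : PadicBase F p hp) * lam γ := by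
      intro j
      induction j with
      | zero => rw [pow_zero, hlam1, Nat.cast_zero, zero_mul]
      | succ j ih => rw [pow_succ, hlam, ih]; push_cast; ring
    have h := hlam ((γ ^ k)⁻¹) (γ ^ k)
    rw [inv_mul_cancel, hlam1, hpow] at h
    linear_combination -h
  -- `D(u_M) = D(g)` for `u_M = (γ^k)⁻¹ g` whenever `g ≡ γ^k` on `K M`
  have hDu : ∀ k : ℕ, D ((γ ^ k)⁻¹ * g) = D g := by
    intro k
    simp only [hD]
    rw [hcoc, hγk_fix, hfinv, hlam, hlaminv, ← ιHom_apply, ← ιHom_apply, ← ιHom_apply, map_add, map_neg, map_mul,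
      map_natCast]
    ring
  -- the nested closed sets
  set C : ℕ → Set (BaseGaloisGroup hp) := fun t =>
    {u | u • zeta F p (n + 1 + t) = zeta F p (n + 1 + t)} ∩ {u | D u = D g} with hC
  have hCne : ∀ t, (C t).Nonempty := by
    intro t
    obtain ⟨k, hk⟩ := exists_pow_gen_smul_eq_of_smul_zeta_eq hp hn (M := n + 1 + t) (by omega) hg
    refine ⟨(γ ^ k)⁻¹ * g, ?_, hDu k⟩
    change ((γ ^ k)⁻¹ * g) • zeta F p (n + 1 + t) = zeta F p (n + 1 + t)
    rw [mul_smul, hk _ (zeta_mem_K hp _), inv_smul_smul]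
  have hCcl : ∀ t, IsClosed (C t) := fun t =>
    (isClosed_setOf_smul_zeta_eq hp _).inter (isClosed_eq hDcont continuous_const)
  have hCdir : Directed (· ⊇ ·) C := by
    refine Antitone.directed_ge fun t t' htt' u hu => ⟨?_, hu.2⟩
    exact smul_zeta_eq_of_le hp (by omega) hu.1
  obtain ⟨u, hu⟩ := IsCompact.nonempty_iInter_of_directed_nonempty_isCompact_isClosed C hCdir hCne
    (fun t => (hCcl t).isCompact) hCcl
  rw [Set.mem_iInter] at hu
  -- `u ∈ H`, where `D` vanishes; but `D u = D g`
  have huH : ∀ M, u • zeta F p M = zeta F p M := fun M =>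
    smul_zeta_eq_of_le hp (show M ≤ n + 1 + M by omega) (hu M).1
  have hDu0 : D u = 0 := by
    simp only [hD]
    rw [hH u huH, hlamH u huH, mul_zero, ← ιHom_apply, map_zero, zero_mul, sub_zero]
  have hDg : D g = 0 := by rw [← (hu 0).2, hDu0]
  simpa only [hD, sub_eq_zero] using hDg

/-! ### Assembly: `f = c · λ + ∂b` -/

/-- **A reduced continuous cocycle trivial on `H` is `c · λ` plus a coboundary.** With `f`, `λ` as in
`mul_apply_eq_mul_apply_gen_of_reduced` and `λ(γ) ≠ 0`: `f(g) = ι(c · λ(g)) + (g • b − b)` for some `c ∈ K₀`,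
`b ∈ ℂ_F` — `c = r₀ / λ(γ)` where `f(γ) = ι r₀` (`exists_apply_gen_eq_ι`), and `b` from the finite layer `K n`
(`FiniteLayer.exists_eq_smul_sub_of_forall_fixingSubgroup`) applied to the cocycle `f − ι(c λ)`, which
vanishes on `Gal(F̄/K n)`. [cite: Tate1967, §3.3 Theorem 1] [cite: FontaineOuyang2022, §3.2 Thm. 3.21] -/
theorem exists_eq_mul_add_coboundary_of_reduced {n : ℕ} (hn : 2 ≤ n)
    (hcoc : ∀ g h : BaseGaloisGroup hp, f (g * h) = f g + g • f h)
    (hH : ∀ h : BaseGaloisGroup hp, (∀ M, h • zeta F p M = zeta F p M) → f h = 0)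
    (hcont : Continuous f)
    (hred : Rhat hp n ⟨f (gen hp n), mem_X hp hcoc hH _⟩ = f (gen hp n))
    (lam : BaseGaloisGroup hp → PadicBase F p hp) (hlam : ∀ g h, lam (g * h) = lam g + lam h)
    (hlamH : ∀ h : BaseGaloisGroup hp, (∀ M, h • zeta F p M = zeta F p M) → lam h = 0)
    (hlamc : Continuous lam) (hlamγ : lam (gen hp n) ≠ 0) :
    ∃ (c : PadicBase F p hp) (b : CompletedAlgClosure F),
      ∀ g : BaseGaloisGroup hp, f g = ι hp (c * lam g) + (g • b - b) := by
  obtain ⟨r₀, hr₀⟩ := exists_apply_gen_eq_ι hp hn hcoc hH hred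
  set c : PadicBase F p hp := r₀ / lam (gen hp n) with hc
  -- `f₂ = f − ι(c λ)` is a cocycle vanishing on `Gal(F̄/K n)`
  set f₂ : BaseGaloisGroup hp → CompletedAlgClosure F := fun g => f g - ι hp (c * lam g) with hf₂
  have hcoc₂ : ∀ g h : BaseGaloisGroup hp, f₂ (g * h) = f₂ g + g • f₂ h := by
    intro g h
    simp only [hf₂]
    rw [hcoc, hlam, smul_sub, base_smul_ι, mul_add, ← ιHom_apply, ← ιHom_apply, ← ιHom_apply, map_add]
    abel
  haveI : FiniteDimensional (PadicBase F p hp) (K hp n) :=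
    IntermediateField.adjoin.finiteDimensional (Algebra.IsIntegral.isIntegral (zeta F p n))
  have hvan₂ : ∀ h : BaseGaloisGroup hp, h ∈ (K hp n).fixingSubgroup → f₂ h = 0 := by
    intro h hh
    have hhζ : h • zeta F p n = zeta F p n := by
      have := hh
      rw [IntermediateField.mem_fixingSubgroup_iff] at this
      exact this _ (zeta_mem_K hp n)
    have key := mul_apply_eq_mul_apply_gen_of_reduced hp hn hcoc hH hcont hred lam hlam hlamH hlamc hhζ
    rw [hr₀, ← ιHom_apply, ← ιHom_apply, ← ιHom_apply, ← map_mul] at key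
    -- `ι(λ γ) f h = ι(λ h r₀)` ⇒ `f h = ι(c λ h)`
    have hιγ : ιHom hp (lam (gen hp n)) ≠ 0 := by
      rw [Ne, map_eq_zero_iff _ (ιHom hp).injective]; exact hlamγ
    simp only [hf₂, sub_eq_zero]
    apply mul_left_cancel₀ hιγ
    rw [key, ← ιHom_apply, ← map_mul, hc]
    congr 1
    field_simp
  obtain ⟨b, hb⟩ := FiniteLayer.exists_eq_smul_sub_of_forall_fixingSubgroup hp (K hp n) f₂ hcoc₂ hvan₂
  refine ⟨c, b, fun g => ?_⟩
  have := hb g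
  simp only [hf₂] at this
  linear_combination this

/-- **Continuity of `f − ∂x`.** [folklore] -/
private theorem continuous_sub_coboundary (hcont : Continuous f) (x : CompletedAlgClosure F) :
    Continuous fun g : BaseGaloisGroup hp => f g - (g • x - x) :=
  hcont.sub ((TateSen.continuous_base_smul_left hp x).sub continuous_const)

/-- **Tate 1967 §3.3 Theorem 1 over the cyclotomic tower — `H¹_cont(Gal(F̄/ℚ_p)/Gal(F̄/ℚ_p(μ_{p^∞})), ℂ_F)` is
the line spanned by (any) continuous additive `λ` killing `H`, PROVED.** Let `f : G₀ → ℂ_F` be a continuous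
`1`-cocycle vanishing on `H = Gal(F̄/K_∞)` (the output shape of `TateSen.baseKer_exists_eq_smul_sub_of_TS1`
after subtracting the coboundary it provides), and `λ : G₀ → K₀` continuous, additive, vanishing on `H`,
with `λ(gen n) ≠ 0` for some `n ≥ 2` (e.g. `λ = log χ_cyclo`: `χ(gen n)` has infinite order, tree
`zpow_chi_gen_ne_one`). Then **`f = c · λ + ∂b`** for some `c ∈ K₀ = ℚ_p`, `b ∈ ℂ_F`. Chain: reduction by one
coboundary from `ker R_n` (`TateH1.exists_reduce`, Tate Prop. 7), the reduced analysis (`f(γ) ∈ ℚ_p`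
`G₀`-fixed via the equivariant idempotent normalised trace), the compactness form of the continuity step
(`mul_apply_eq_mul_apply_gen_of_reduced`), and the finite layer `Gal(K n/ℚ_p)` (`FiniteLayerCoboundary`).
[cite: Tate1967, §3.2 Prop. 7–8, §3.3 Theorem 1] [cite: FontaineOuyang2022, §3.2 Thm. 3.21] -/
theorem exists_eq_mul_add_coboundary {n : ℕ} (hn : 2 ≤ n)
    (hcoc : ∀ g h : BaseGaloisGroup hp, f (g * h) = f g + g • f h)
    (hH : ∀ h : BaseGaloisGroup hp, (∀ M, h • zeta F p M = zeta F p M) → f h = 0)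
    (hcont : Continuous f)
    (lam : BaseGaloisGroup hp → PadicBase F p hp) (hlam : ∀ g h, lam (g * h) = lam g + lam h)
    (hlamH : ∀ h : BaseGaloisGroup hp, (∀ M, h • zeta F p M = zeta F p M) → lam h = 0)
    (hlamc : Continuous lam) (hlamγ : lam (gen hp n) ≠ 0) :
    ∃ (c : PadicBase F p hp) (b : CompletedAlgClosure F),
      ∀ g : BaseGaloisGroup hp, f g = ι hp (c * lam g) + (g • b - b) := by
  -- reduction by one coboundary
  obtain ⟨x, hx, hx0, hxγ⟩ := exists_reduce hp hn hcoc hH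
  set f₁ : BaseGaloisGroup hp → CompletedAlgClosure F := fun g => f g - (g • x - x) with hf₁
  have hcoc₁ : ∀ g h : BaseGaloisGroup hp, f₁ (g * h) = f₁ g + g • f₁ h := fun g h =>
    cocycle_sub_coboundary hp hcoc x g h
  have hH₁ : ∀ h : BaseGaloisGroup hp, (∀ M, h • zeta F p M = zeta F p M) → f₁ h = 0 := fun h hh =>
    sub_coboundary_apply_of_mem hp hH hx h hh
  have hcont₁ : Continuous f₁ := continuous_sub_coboundary hp hcont x
  have hred₁ : Rhat hp n ⟨f₁ (gen hp n), mem_X hp hcoc₁ hH₁ _⟩ = f₁ (gen hp n) := by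
    have h1 : (⟨f₁ (gen hp n), mem_X hp hcoc₁ hH₁ _⟩ : X hp) =
        ⟨Rhat hp n ⟨f (gen hp n), mem_X hp hcoc hH _⟩, Rhat_mem_X hp hn _⟩ := Subtype.ext hxγ
    rw [h1, Rhat_Rhat hp hn]
    exact hxγ.symm
  obtain ⟨c, b, hb⟩ := exists_eq_mul_add_coboundary_of_reduced hp hn hcoc₁ hH₁ hcont₁ hred₁ lam hlam hlamH hlamc hlamγ
  refine ⟨c, b + x, fun g => ?_⟩
  have := hb g
  simp only [hf₁] at this
  rw [smul_add]
  linear_combination this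

end TateH1


end Literature.NumberTheory.PAdicHodge

end
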